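import Summits.ABC.StewartYu.PadicG3SatNStub
import Summits.ABC.StewartYu.PadicG3SatNCountB
import HarnessLib

/-!
# Cell abc-stewartyu, WP-L.P(odd) (crux r3 `PadicCoreOddRat`, stmt-ABC-20503): the SLIM record package — pack assembly with the START order
# `(69/4)(n+1)LgV` (p1's `MordN_T0_le'`) and the Siegel count (B1) discharged (`startCountSatN'`)

`Summits/ABC/StewartYu/PadicG3SatNPackB.lean` — cell `abc-stewartyu` (seat p2-g6; pack twin; record owner p1 g11).  Proofs only; no definition, no
named fact.  Same wiring as `PadicG3SatNPack.ineqPackSat_schedN_one` / `PadicG3SatNStub.recordSupplyOddSatRD_of_package` with two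
simplifications the record owner asked for implicitly: the budget lines read `T0r := (69/4)(n+1)LgV` (v2's exact START order, so the M3 atoms
`T0r_SdG_le`/`T0r_HV_le`/`T0r_logn_le` apply verbatim), and the count (B1) is no longer a package conjunct (fields `K₀ = p − 1`, `gⁿ ≤ K` instead).

* `TordS_N_zero_real_le'`, `ineqPackSat_schedN_one'`, `recordSupplyOddSatRD_of_package'`.

References: Yu. V. Nesterenko, LNM 1819 (2003) Prop 4.1, Lemma 4.3, §4.3, §5 (shape only).
-/

noncomputable section

open Finset Real Matrix
open Literature.NumberTheory.Transcendental
open Literature.NumberTheory.Transcendental.PadicCW77 (condExp)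
open Literature.NumberTheory.Transcendental.CW77.Setup (Tau tauNorm)
open Summit.ABC.StewartYu.GenThreeFrameSpecOdd (RecordOdd)

namespace Summit.ABC.StewartYu

namespace G3Setup

variable {p : ℕ} [Fact p.Prime] (S : G3Setup p)

/-- **`TordS (schedN b) 0 0 ≤ (69/4)(n+1)·LgV`** (real; p1's `MordN_T0_le'`, `N_q = K`, `gⁿ ≤ K`). [folklore] -/
theorem TordS_N_zero_real_le' (P : PadicG3ParN S.n) (b : ℝ) (hNq : P.Nq = P.K) (hgK : P.g ^ S.n ≤ (P.K : ℝ)) :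
    (S.TordS (P.schedN b) 0 0 : ℝ) ≤ (69 / 4) * (S.n + 1) * P.LgV := by
  rw [S.TordS_N P b]
  have h := P.MordN_T0_le' hNq hgK
  simp only [Nat.sub_zero]
  push_cast
  nlinarith [h]

section Pack

variable (F : S.SatData) (P : PadicG3ParN S.n)

/-- **THE SATURATED INEQUALITY PACK at `schedN 1` from the record's count, smallness and four budget inequalities.**
Version ′: the START order in v2's exact shape `T0r := (69/4)(n+1)LgV` (p1's `MordN_T0_le'`) and (B1) DISCHARGED (`startCountSatN'`).
[cite: Nesterenko2003, Prop 4.1, Lemma 4.3, §4.3; shape only] -/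
theorem ineqPackSat_schedN_one' (hp : P.p = p) (hK₀ : P.K₀ = p - 1) (hgK : P.g ^ S.n ≤ (P.K : ℝ)) (hθ : P.θ₀ = 1 / 2) (hn2 : 2 ≤ S.n)
    (hA1 : ∀ j, 1 ≤ P.A j)
    (hαA : ∀ j, Height.logHeight₁ (F.αo j) ≤ P.A j) (hbW : ∀ j, Real.log (max 3 (|S.b j| : ℝ)) ≤ P.W)
    (hC : ∀ j k, |F.C j k| ≤ ((S.n.factorial * F.N : ℕ) : ℤ)) (hUcol : ∀ j, (F.Ucol j : ℤ) ≤ S.n * F.N)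
    (hθA : ∀ i, Height.logHeight₁ (S.α i) ≤ ∑ j, P.A j) (hdet : (F.N : ℤ) = |F.C.det|) (hPN : P.N = F.N) (hNq : P.Nq = P.K)
    (hNCW : Real.log F.N + Real.log S.n.factorial + 3 * Real.log S.n ≤ P.W)
    {U : ℝ} (hΛU : ‖S.Λ / (S.b S.j₀ : ℚ_[p])‖ ≤ Real.exp (-U))
    (hKfar : ∀ ν, ν + 1 ≤ S.n → P.L0N * (P.G + 1) +
      (4 * Real.log 2 + 2 * (Real.log ((P.L0N : ℝ) + 1) + S.n * Real.log (S.n * S.n.factorial * F.N * P.LV + 1)) +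
        2 * (((69 / 4) * (S.n + 1) * P.LgV) * (P.SdN * Real.log 2 + 23 / 20 * P.HV + (P.HV + P.W))) +
        2 * (P.HV / Real.exp 1) + 2 * (P.L0N * ((P.SdN + S.n + 6) * Real.log 2)) + 2 * P.htsV 0 + 4 * P.htsV ν + 8 * ∑ j, P.A j) <
      8 * 2 ^ ν * P.Zp)
    (hKlam : ∀ lev ν, lev ≤ P.SdN → ν + 1 ≤ S.n → P.L0N * (P.G + 1) + P.AcondV lev ν +
      (4 * Real.log 2 + 2 * (Real.log ((P.L0N : ℝ) + 1) + S.n * Real.log (S.n * S.n.factorial * F.N * P.LV + 1)) +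
        2 * (((69 / 4) * (S.n + 1) * P.LgV) * (P.SdN * Real.log 2 + 23 / 20 * P.HV + (P.HV + P.W))) +
        2 * (P.HV / Real.exp 1) + 2 * (P.L0N * ((P.SdN + S.n + 6) * Real.log 2)) + 2 * P.htsV 0 + 4 * P.htsV ν + 8 * ∑ j, P.A j) < U)
    (hHfar : P.L0N * (P.G + 1) + 2 ^ (S.n + 1) *
      (6 * Real.log 2 + 2 * (Real.log ((P.L0N : ℝ) + 1) + S.n * Real.log (S.n * S.n.factorial * F.N * P.LV + 1)) +
        ((69 / 4) * (S.n + 1) * P.LgV) * (P.SdN * Real.log 2 + 23 / 20 * P.HV + (P.HV + P.W)) +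
        2 * (P.HV / Real.exp 1) + 2 * (P.L0N * ((P.SdN + S.n + 6) * Real.log 2)) +
        8 * P.htsV 0 + (2 * P.LgV + (S.n + 1) * (8 * P.LgV + 2 * P.SdN)) * (P.SdN * Real.log 2 + Real.log 2 + 69 / 20 * P.HV + 2 * P.W + (P.HV + P.W)) +
        (6 * S.n + 10) * ∑ j, P.A j) < 8 * 2 ^ S.n * P.Zp)
    (hHlam : ∀ lev, lev < P.SdN → P.L0N * (P.G + 1) + P.AcondV lev S.n + 2 ^ (S.n + 1) *
      (6 * Real.log 2 + 2 * (Real.log ((P.L0N : ℝ) + 1) + S.n * Real.log (S.n * S.n.factorial * F.N * P.LV + 1)) +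
        ((69 / 4) * (S.n + 1) * P.LgV) * (P.SdN * Real.log 2 + 23 / 20 * P.HV + (P.HV + P.W)) +
        2 * (P.HV / Real.exp 1) + 2 * (P.L0N * ((P.SdN + S.n + 6) * Real.log 2)) +
        8 * P.htsV 0 + (2 * P.LgV + (S.n + 1) * (8 * P.LgV + 2 * P.SdN)) * (P.SdN * Real.log 2 + Real.log 2 + 69 / 20 * P.HV + 2 * P.W + (P.HV + P.W)) +
        (6 * S.n + 10) * ∑ j, P.A j) < U) :
    S.IneqPackSat F (P.schedN 1) := by
  have hn1 : 1 ≤ S.n := by omega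
  have hb : (1 : ℝ) ≤ 1 := le_rfl
  have hT0 := S.TordS_N_zero_real_le' P 1 hNq hgK
  have hcX := S.cX_of_hNCW F P hPN hNCW
  have hzeros := P.zerosV_ge'
  refine ⟨S.startCountSat_of_record F (P.schedN 1) hdet (S.startCountSatN' P hp hK₀ hNq hgK hPN), ?_, ?_, ?_, ?_⟩
  · -- level-0 k-steps
    intro ν hν x₁ hx τ hτ
    have hτ' : tauNorm τ ≤ S.TordS (P.schedN 1) 0 0 := by
      have := S.TordS_N_le_zero P 1 0 ν; omega
    have hE : P.zerosV 0 ν ≤ P.G * (((2 * S.NS (P.schedN 1) 0 ν + 1) * S.tS (P.schedN 1) 0 : ℕ) : ℝ) := P.zerosV_le_gain 0 ν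
    have hz := hzeros 0 ν
    refine S.kstep_line_N F P 1 hp hθ hb hn1 hA1 hαA hbW hC hT0 hcX hΛU (Nat.zero_le _) (by omega) hx τ hτ' (by omega) le_rfl ?_ ?_
    · have h := hKfar ν (by omega)
      unfold PadicG3Par.Zp at h hz
      linarith
    · have h := hKlam 0 ν (Nat.zero_le _) (by omega)
      linarith
  · -- Kummer half-steps
    intro lev hlev s₁ _ hs τ hτ
    have hlev' : lev < P.SdN := hlev
    have hTh := S.TordS_N_half_sub_real_le P 1 lev
    have hE : P.zerosV lev S.n ≤ P.G * (((2 * S.NS (P.schedN 1) lev S.n + 1) * S.tS (P.schedN 1) lev : ℕ) : ℝ) := P.zerosV_le_gain lev S.n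
    have hz := hzeros lev S.n
    refine S.half_line_N F P 1 hp hθ hb hn1 hA1 hαA hbW hC hUcol hθA hT0 hcX hTh hΛU hlev' hs τ hτ ?_ ?_
    · unfold PadicG3Par.Zp at hHfar hz
      linarith
    · have h := hHlam lev hlev'
      linarith
  · -- odd-node k-steps
    intro lev hlev x₁ hx τ hτ
    have hτ' : tauNorm τ ≤ S.TordS (P.schedN 1) 0 0 := by
      have := S.TordS_N_le_zero P 1 (lev + 1) 0; omega
    have hlev' : lev + 1 ≤ P.SdN := hlev
    have hk1 : 1 ≤ 2 * S.NhS (P.schedN 1) (lev + 1) := by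
      rw [S.NhS_N P 1]; have := P.one_le_XsV (lev + 1); omega
    have hk : 2 * S.NhS (P.schedN 1) (lev + 1) ≤ 2 * S.NS (P.schedN 1) (lev + 1) 0 + 1 := by
      rw [S.NhS_N P 1, S.NS_N P 1, pow_zero, one_mul]; omega
    have hE : P.zerosV (lev + 1) 0 ≤ P.G * (((2 * S.NhS (P.schedN 1) (lev + 1)) * S.tS (P.schedN 1) (lev + 1) : ℕ) : ℝ) := by
      rw [S.NhS_N P 1, S.tS_N P 1]
      unfold PadicG3Par.zerosV
      push_cast
      ring_nf
      exact le_rfl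
    have hz := hzeros (lev + 1) 0
    refine S.kstep_line_N F P 1 hp hθ hb hn1 hA1 hαA hbW hC hT0 hcX hΛU hlev' (by omega) hx τ hτ' hk1 hk ?_ ?_
    · have h := hKfar 0 (by omega)
      unfold PadicG3Par.Zp at h hz
      simp only [pow_zero, mul_one] at h hz
      linarith
    · have h := hKlam (lev + 1) 0 hlev' (by omega)
      linarith
  · -- symmetric k-steps of the levels ≥ 1
    intro lev hlev ν hν1 hνn x₁ hx τ hτ
    have hτ' : tauNorm τ ≤ S.TordS (P.schedN 1) 0 0 := by
      have := S.TordS_N_le_zero P 1 (lev + 1) ν; omega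
    have hlev' : lev + 1 ≤ P.SdN := hlev
    have hE : P.zerosV (lev + 1) ν ≤ P.G * (((2 * S.NS (P.schedN 1) (lev + 1) ν + 1) * S.tS (P.schedN 1) (lev + 1) : ℕ) : ℝ) :=
      P.zerosV_le_gain (lev + 1) ν
    have hz := hzeros (lev + 1) ν
    refine S.kstep_line_N F P 1 hp hθ hb hn1 hA1 hαA hbW hC hT0 hcX hΛU hlev' (by omega) hx τ hτ' (by omega) le_rfl ?_ ?_
    · have h := hKfar ν (by omega)
      unfold PadicG3Par.Zp at h hz
      linarith
    · have h := hKlam (lev + 1) ν hlev' (by omega)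
      linarith

end Pack

/-- **`RecordSupplyOddSatRD (c^·) p n` FROM ONE RECORD PACKAGE** (`n ≥ 2`, `p` odd, `c ≥ 256`).  The package `hR` is what the record owner
proves for each admissible saturated set-up; everything else is the frame's algebra.  Version ′: no (B1) conjunct (discharged by `startCountSatN'`
from `K₀ = p − 1`, `gⁿ ≤ K`), START order `(69/4)(n+1)LgV`. [cite: Nesterenko2003, Prop 4.1, §5; shape only] -/
theorem recordSupplyOddSatRD_of_package' {n : ℕ} (hn2 : 2 ≤ n) (hp2 : p ≠ 2) {c : ℝ} (hc : 256 ≤ c)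
    (hR : ∀ (S : G3Setup p) (F : S.SatData) (V : Fin S.n → ℝ) (Vmax W : ℝ), S.n = n →
      (∀ j, padicValRat p (F.αo j) = 0) → (∀ i, padicValRat p (S.α i) = 0) →
      (∀ j, Height.logHeight₁ (F.αo j) ≤ V j) → (∀ j, 1 ≤ V j) → (∀ j, V j ≤ Vmax) →
      (∀ j, Real.log (max 3 (|F.bo j| : ℝ)) ≤ W) → 1 ≤ W →
      ¬ (padicValRat p (∏ j, F.αo j ^ F.bo j - 1) : ℝ) * Real.log p ≤
          c ^ S.n * ((p : ℝ) / Real.log p) * (∏ j, V j) * (W + Real.log p + Real.log (2 * Vmax)) →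
      (F.N : ℝ) ≤ ∏ j, (2 * V j / Real.log 2) →
      (∀ j, (F.Ucol j : ℤ) ≤ (S.n : ℤ) * F.N) → (∀ j k, |F.C j k| ≤ ((S.n.factorial * F.N : ℕ) : ℤ)) →
      (∀ i, Height.logHeight₁ (S.α i) ≤ ∑ j, V j) → ((F.N : ℤ) = |F.C.det|) →
      ∃ (P : PadicG3ParN S.n) (U : ℝ), P.p = p ∧ P.K₀ = p - 1 ∧ P.g ^ S.n ≤ (P.K : ℝ) ∧ P.θ₀ = 1 / 2 ∧ P.Nq = P.K ∧ 2 ≤ P.K ∧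
        P.N = F.N ∧ P.A = V ∧
        Real.log F.N + Real.log S.n.factorial + 3 * Real.log S.n ≤ P.W ∧
        Real.log ((S.n : ℝ) * ((S.n.factorial * F.N : ℕ) : ℝ)) + W ≤ P.W ∧
        ‖S.Λ / (S.b S.j₀ : ℚ_[p])‖ ≤ Real.exp (-U) ∧
        (∀ ν, ν + 1 ≤ S.n → P.L0N * (P.G + 1) +
          (4 * Real.log 2 + 2 * (Real.log ((P.L0N : ℝ) + 1) + S.n * Real.log (S.n * S.n.factorial * F.N * P.LV + 1)) +
            2 * (((69 / 4) * (S.n + 1) * P.LgV) * (P.SdN * Real.log 2 + 23 / 20 * P.HV + (P.HV + P.W))) +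
            2 * (P.HV / Real.exp 1) + 2 * (P.L0N * ((P.SdN + S.n + 6) * Real.log 2)) + 2 * P.htsV 0 + 4 * P.htsV ν + 8 * ∑ j, P.A j) <
          8 * 2 ^ ν * P.Zp) ∧
        (∀ lev ν, lev ≤ P.SdN → ν + 1 ≤ S.n → P.L0N * (P.G + 1) + P.AcondV lev ν +
          (4 * Real.log 2 + 2 * (Real.log ((P.L0N : ℝ) + 1) + S.n * Real.log (S.n * S.n.factorial * F.N * P.LV + 1)) +
            2 * (((69 / 4) * (S.n + 1) * P.LgV) * (P.SdN * Real.log 2 + 23 / 20 * P.HV + (P.HV + P.W))) +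
            2 * (P.HV / Real.exp 1) + 2 * (P.L0N * ((P.SdN + S.n + 6) * Real.log 2)) + 2 * P.htsV 0 + 4 * P.htsV ν + 8 * ∑ j, P.A j) < U) ∧
        (P.L0N * (P.G + 1) + 2 ^ (S.n + 1) *
          (6 * Real.log 2 + 2 * (Real.log ((P.L0N : ℝ) + 1) + S.n * Real.log (S.n * S.n.factorial * F.N * P.LV + 1)) +
            ((69 / 4) * (S.n + 1) * P.LgV) * (P.SdN * Real.log 2 + 23 / 20 * P.HV + (P.HV + P.W)) +
            2 * (P.HV / Real.exp 1) + 2 * (P.L0N * ((P.SdN + S.n + 6) * Real.log 2)) +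
            8 * P.htsV 0 + (2 * P.LgV + (S.n + 1) * (8 * P.LgV + 2 * P.SdN)) * (P.SdN * Real.log 2 + Real.log 2 + 69 / 20 * P.HV + 2 * P.W + (P.HV + P.W)) +
            (6 * S.n + 10) * ∑ j, P.A j) < 8 * 2 ^ S.n * P.Zp) ∧
        (∀ lev, lev < P.SdN → P.L0N * (P.G + 1) + P.AcondV lev S.n + 2 ^ (S.n + 1) *
          (6 * Real.log 2 + 2 * (Real.log ((P.L0N : ℝ) + 1) + S.n * Real.log (S.n * S.n.factorial * F.N * P.LV + 1)) +
            ((69 / 4) * (S.n + 1) * P.LgV) * (P.SdN * Real.log 2 + 23 / 20 * P.HV + (P.HV + P.W)) +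
            2 * (P.HV / Real.exp 1) + 2 * (P.L0N * ((P.SdN + S.n + 6) * Real.log 2)) +
            8 * P.htsV 0 + (2 * P.LgV + (S.n + 1) * (8 * P.LgV + 2 * P.SdN)) * (P.SdN * Real.log 2 + Real.log 2 + 69 / 20 * P.HV + 2 * P.W + (P.HV + P.W)) +
            (6 * S.n + 10) * ∑ j, P.A j) < U) ∧
        RecordOdd (fun m => c ^ m) p S.n V Vmax W P.D0N P.S0NV (S.XfinOS (P.schedN 1)) P.DN) :
    RecordSupplyOddSatRD (fun m => c ^ m) p n := by
  intro S F V Vmax W hSn hαv hθv hV hV1 hVm hWbo hW1 hneg hNV hUcol hCb hθV hdet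
  have hn1 : 1 ≤ S.n := by omega
  have hn2' : 2 ≤ S.n := by omega
  obtain ⟨P, U, hPp, hK₀, hgK, hθ, hNq, hK2, hPN, hPA, hNCW, hWbW, hΛU, hKfar, hKlam, hHfar, hHlam, hrec⟩ :=
    hR S F V Vmax W hSn hαv hθv hV hV1 hVm hWbo hW1 hneg hNV hUcol hCb hθV hdet
  -- record-side hypotheses in `P`'s letters
  have hA1 : ∀ j, 1 ≤ P.A j := fun j => by rw [hPA]; exact hV1 j
  have hαA : ∀ j, Height.logHeight₁ (F.αo j) ≤ P.A j := fun j => by rw [hPA]; exact hV j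
  have hθA : ∀ i, Height.logHeight₁ (S.α i) ≤ ∑ j, P.A j := fun i => by rw [hPA]; exact hθV i
  -- the directions `b̃ = bo ᵥ* C`: `log max(3,|b̃ₖ|) ≤ log(n·(n!·N)) + W`
  have hM1 : 1 ≤ S.n.factorial * F.N := Nat.one_le_iff_ne_zero.mpr (Nat.mul_ne_zero S.n.factorial_pos.ne' (by have := F.hN; omega))
  have hbW' : ∀ k, Real.log (max 3 (|S.b k| : ℝ)) ≤ Real.log ((S.n : ℝ) * ((S.n.factorial * F.N : ℕ) : ℝ)) + W := by
    intro k
    have h := log_max_three_vecMul_le hn1 F.bo F.C hM1 hCb hWbo k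
    rw [← F.hb] at h
    exact h
  have hbW : ∀ k, Real.log (max 3 (|S.b k| : ℝ)) ≤ P.W := fun k => (hbW' k).trans hWbW
  -- the `Λ`-order line at the datum `W` with directions of size `Wb ≤ 4ⁿ(W + log 2Vmax)`
  have hWbR := Wb_le_pow (V := V) hn1 F.hN hV1 hVm hW1 hNV
  have hnegS : ¬ (padicValRat p (∏ j, S.α j ^ S.b j - 1) : ℝ) * Real.log p ≤
      c ^ S.n * ((p : ℝ) / Real.log p) * (∏ j, V j) * (W + Real.log p + Real.log (2 * Vmax)) := by
    rw [F.prod_zpow_b_eq]; exact hneg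
  obtain ⟨hne, hord⟩ := S.ordLine_of_negBound_sat hp2 hn2' V Vmax W _ hV1 hVm hbW' hW1 hWbR hc hnegS P.toPadicG3Par hPp
  -- the pack, the END sizing, the supply
  have hpack := S.ineqPackSat_schedN_one' F P hPp hK₀ hgK hθ hn2' hA1 hαA hbW hCb hUcol hθA hdet hPN hNq hNCW hΛU hKfar hKlam hHfar hHlam
  obtain ⟨hXfin, hSfin, hD₀, hD⟩ := S.endSizingSatN F P 1 hPN hK2 le_rfl
  exact S.recordSupplyAtSatR_of_pack F (P.schedN 1) hn1 (fun m => c ^ m) V Vmax W _ _ _ _ hne hord hpack hXfin hSfin hD₀ hD hrec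

end G3Setup

end Summit.ABC.StewartYu

end
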